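import Mathlib
import HarnessLib
import Summits.CriticalPhenomena.SAWScalingLimit.Theses.SAWMassiveIsingTilt
import Summits.CriticalPhenomena.SAWScalingLimit.Theses.SAWTrackTransport

/-!
# `LatticeUniversality` (crux stmt-CriticalPhenomena-0807) — glue of the route-level split along the
# Yang–Baxter relay (hexagonal end `Θ ≡ π/3` → square end `Θ ≡ π/2` → uniform `δℤ²`)

Crux (route `SAWMassiveIsingTilt`, rank 4; identical body in six sibling routes):
`LatticeUniversality` = asymptotic equality, on bounded continuous test functions, of the critical
chordal SAW laws of `δℤ²` (`SAW.law`) and of `δHex` (`SAW.hexSAWLaw`) in every Dobrushin domain and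
for EVERY pair of endpoint approximations — an (A)-free statement ((A) = DCS 2012 Conjecture 1).

The crux-strategist census (`Cruxes/LatticeUniversality/STRATEGY-CENSUS.md`, §Decomposition d3) cuts
the crux into three pieces, each strictly weaker than the corresponding stub(s) of the registered
line `Cruxes/LatticeUniversality/Lines/birth.lean` (∃-forms: the intermediate Glazman–Manolescu
endpoint approximations may be CHOSEN), and this workfile (planners cannot write under Theorems/, D-0016: a prover lands the
identical theorem as `Theorems/SAWMassiveIsingTiltLatticeUniversalitySplit.lean`, registered sub-goal
`LatticeUniversality_of_subs` of stmt-0807) records their composition, sorry-free, with the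
three child STATEMENTS written out verbatim as hypotheses (so that `route edit --split … --glue-by`
matches by unfolding the children only):

* child 1 `HexToThirdYB` — convention bridge at the hexagonal end: for every hexagonal endpoint
  approximation there is a `π/3` mid-edge endpoint approximation whose critical Glazman–Manolescu
  law `ybLaw (Θ ≡ π/3)` is asymptotically the hexagonal law `hexSAWLaw` (same model, two
  discretisations; GM19 p. 4);
* child 2 `ThirdToSquareYB` — law-level Yang–Baxter transport inside the family: for every `π/3`
  endpoint approximation there is a square-tiling (`π/2`) one with asymptotically the same law
  (the hardest piece; `n = 0` analogue of DKKMO Thm 2.1 with the hexagonal lattice as reference);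
* child 3 = `SAWTrackTransport.YBtoUniform` (item stmt-CriticalPhenomena-16966, verbatim) — the
  off-family toll, square-tiling Yang–Baxter law ↔ uniform critical `δℤ²` law.

Proof = the two-ε argument: `∫f dP^{ℤ²} − ∫f dP^{Hex} = (∫f dP^{ℤ²} − ∫f dQ^{π/2}) + (∫f dQ^{π/3} − ∫f dQ^{π/2})·(−1)·(−1) …`,
precisely `(P^{ℤ²} − Q^{π/2}) − (P^{Hex} − Q^{π/3}) − (Q^{π/3} − Q^{π/2})`, each bracket `→ 0`.
-/

noncomputable section

namespace Summit.CriticalPhenomena.SAWScalingLimit.Cruxes.LatticeUniversality.Split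

open MeasureTheory Filter Topology Set
open scoped NNReal ENNReal BoundedContinuousFunction
open Literature.Probability.RandomPlanarGeometry
open Literature.Probability.RandomPlanarGeometry.SAW
open Literature.Probability.RandomPlanarGeometry.SAW.YangBaxter
open Literature.Probability.LatticeModels (Site HexVertex hexGraph hexCenter)
open Summit.CriticalPhenomena.SAWScalingLimit.Theses

/-- **Glue of the split** `HexToThirdYB → ThirdToSquareYB → YBtoUniform → LatticeUniversality`
(route `SAWMassiveIsingTilt`, crux stmt-CriticalPhenomena-0807), the three child statements written
out. Fix `D`, a `δℤ²` endpoint approximation `(a, b)`, a hexagonal one `(a', b')` and `f`; child 1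
gives a `π/3` approximation `(a₃, b₃)` with `∫f dP^{Hex} − ∫f dQ^{π/3} → 0`, child 2 a square-tiling
one `(a₂, b₂)` with `∫f dQ^{π/3} − ∫f dQ^{π/2} → 0`, child 3 gives `∫f dP^{ℤ²} − ∫f dQ^{π/2} → 0`;
subtract. [folklore] -/
theorem LatticeUniversality_of_subs
    (h1 : ∀ (D : DobrushinDomain) (a b : ℝ → HexVertex),
      SAW.IsEmbEndpointApprox hexGraph hexCenter D a b →
      ∃ a' b' : ℝ → MidEdge, IsYBEndpointApprox (fun (_ : ℤ) => Real.pi / 3) D a' b' ∧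
        ∀ f : BoundedContinuousFunction (CurveClass ℂ) ℝ,
          Tendsto (fun δ : ℝ => (∫ γ, f γ.curve ∂(SAW.hexSAWLaw D.carrier δ (a δ) (b δ))) -
              ∫ γ, f (γ.curve (fun (_ : ℤ) => Real.pi / 3) δ)
                ∂(ybLaw (fun (_ : ℤ) => Real.pi / 3) D.carrier δ 1 (a' δ) (b' δ)))
            (𝓝[>] (0 : ℝ)) (𝓝 0))
    (h2 : ∀ (D : DobrushinDomain) (a b : ℝ → MidEdge),
      IsYBEndpointApprox (fun (_ : ℤ) => Real.pi / 3) D a b →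
      ∃ a' b' : ℝ → MidEdge, IsYBEndpointApprox (fun (_ : ℤ) => Real.pi / 2) D a' b' ∧
        ∀ f : BoundedContinuousFunction (CurveClass ℂ) ℝ,
          Tendsto (fun δ : ℝ =>
              (∫ γ, f (γ.curve (fun (_ : ℤ) => Real.pi / 3) δ)
                  ∂(ybLaw (fun (_ : ℤ) => Real.pi / 3) D.carrier δ 1 (a δ) (b δ))) -
                ∫ γ, f (γ.curve (fun (_ : ℤ) => Real.pi / 2) δ)
                  ∂(ybLaw (fun (_ : ℤ) => Real.pi / 2) D.carrier δ 1 (a' δ) (b' δ)))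
            (𝓝[>] (0 : ℝ)) (𝓝 0))
    (h3 : SAWTrackTransport.YBtoUniform) :
    SAWMassiveIsingTilt.LatticeUniversality := by
  intro D a b a' b' hab hab' f
  obtain ⟨a₃, b₃, hab₃, hH⟩ := h1 D a' b' hab'
  obtain ⟨a₂, b₂, hab₂, hA⟩ := h2 D a₃ b₃ hab₃
  -- ℤ² − Q^{π/2} → 0 (toll), Hex − Q^{π/3} → 0 (conventions), Q^{π/3} − Q^{π/2} → 0 (transport)
  have hZ := h3 D a b a₂ b₂ hab hab₂ f
  have h := (hZ.sub (hH f)).sub (hA f)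
  simp only [sub_zero] at h
  exact h.congr fun δ => by ring

/-- The children are implied by the four stubs of the registered line `birth` (so closing that
line's stubs closes the split): `ThirdEndpoints ∧ HexThirdConventions` (∀∀-form) give child 1, and
`AngleTransport` (∀∀-form) with the existence of square-tiling endpoint approximations gives child 2.
Stated with the stub statements written out; pure logic. [folklore] -/
theorem children_of_birth_stubs
    (h0 : ∀ D : DobrushinDomain, ∃ a b : ℝ → MidEdge,
      IsYBEndpointApprox (fun (_ : ℤ) => Real.pi / 3) D a b)
    (h1 : ∀ (D : DobrushinDomain) (a b : ℝ → HexVertex) (a' b' : ℝ → MidEdge),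
      SAW.IsEmbEndpointApprox hexGraph hexCenter D a b →
      IsYBEndpointApprox (fun (_ : ℤ) => Real.pi / 3) D a' b' →
      ∀ f : BoundedContinuousFunction (CurveClass ℂ) ℝ,
        Tendsto (fun δ : ℝ => (∫ γ, f γ.curve ∂(SAW.hexSAWLaw D.carrier δ (a δ) (b δ))) -
            ∫ γ, f (γ.curve (fun (_ : ℤ) => Real.pi / 3) δ)
              ∂(ybLaw (fun (_ : ℤ) => Real.pi / 3) D.carrier δ 1 (a' δ) (b' δ)))
          (𝓝[>] (0 : ℝ)) (𝓝 0))
    (h2 : ∀ (D : DobrushinDomain) (a b a' b' : ℝ → MidEdge),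
      IsYBEndpointApprox (fun (_ : ℤ) => Real.pi / 3) D a b →
      IsYBEndpointApprox (fun (_ : ℤ) => Real.pi / 2) D a' b' →
      ∀ f : BoundedContinuousFunction (CurveClass ℂ) ℝ,
        Tendsto (fun δ : ℝ =>
            (∫ γ, f (γ.curve (fun (_ : ℤ) => Real.pi / 3) δ)
                ∂(ybLaw (fun (_ : ℤ) => Real.pi / 3) D.carrier δ 1 (a δ) (b δ))) -
              ∫ γ, f (γ.curve (fun (_ : ℤ) => Real.pi / 2) δ)
                ∂(ybLaw (fun (_ : ℤ) => Real.pi / 2) D.carrier δ 1 (a' δ) (b' δ)))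
          (𝓝[>] (0 : ℝ)) (𝓝 0))
    (hsq : ∀ D : DobrushinDomain, ∃ a b : ℝ → MidEdge,
      IsYBEndpointApprox (fun (_ : ℤ) => Real.pi / 2) D a b) :
    (∀ (D : DobrushinDomain) (a b : ℝ → HexVertex),
      SAW.IsEmbEndpointApprox hexGraph hexCenter D a b →
      ∃ a' b' : ℝ → MidEdge, IsYBEndpointApprox (fun (_ : ℤ) => Real.pi / 3) D a' b' ∧
        ∀ f : BoundedContinuousFunction (CurveClass ℂ) ℝ,
          Tendsto (fun δ : ℝ => (∫ γ, f γ.curve ∂(SAW.hexSAWLaw D.carrier δ (a δ) (b δ))) -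
              ∫ γ, f (γ.curve (fun (_ : ℤ) => Real.pi / 3) δ)
                ∂(ybLaw (fun (_ : ℤ) => Real.pi / 3) D.carrier δ 1 (a' δ) (b' δ)))
            (𝓝[>] (0 : ℝ)) (𝓝 0)) ∧
    (∀ (D : DobrushinDomain) (a b : ℝ → MidEdge),
      IsYBEndpointApprox (fun (_ : ℤ) => Real.pi / 3) D a b →
      ∃ a' b' : ℝ → MidEdge, IsYBEndpointApprox (fun (_ : ℤ) => Real.pi / 2) D a' b' ∧
        ∀ f : BoundedContinuousFunction (CurveClass ℂ) ℝ,
          Tendsto (fun δ : ℝ =>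
              (∫ γ, f (γ.curve (fun (_ : ℤ) => Real.pi / 3) δ)
                  ∂(ybLaw (fun (_ : ℤ) => Real.pi / 3) D.carrier δ 1 (a δ) (b δ))) -
                ∫ γ, f (γ.curve (fun (_ : ℤ) => Real.pi / 2) δ)
                  ∂(ybLaw (fun (_ : ℤ) => Real.pi / 2) D.carrier δ 1 (a' δ) (b' δ)))
            (𝓝[>] (0 : ℝ)) (𝓝 0)) := by
  refine ⟨fun D a b hab => ?_, fun D a b hab => ?_⟩
  · obtain ⟨a', b', hab'⟩ := h0 D
    exact ⟨a', b', hab', h1 D a b a' b' hab hab'⟩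
  · obtain ⟨a', b', hab'⟩ := hsq D
    exact ⟨a', b', hab', h2 D a b a' b' hab hab'⟩

end Summit.CriticalPhenomena.SAWScalingLimit.Cruxes.LatticeUniversality.Split

end
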